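import Summits.CriticalPhenomena.SAWScalingLimit.Theses.SAWResidueField
import Summits.CriticalPhenomena.SAWScalingLimit.Theorems.SAWDefectDecoherenceObservableToSLERResidueAssemblyMacro
import Summits.CriticalPhenomena.SAWScalingLimit.Theorems.SAWDevelopingMapObservableToSLETypeLadderCarvedReductionSqueezeGeometry
import Summits.CriticalPhenomena.SAWScalingLimit.Theorems.SAWDevelopingMapObservableToSLETypeLadderCarvedReductionSqueezeRatio
import HarnessLib

/-!
# Crux `SAWResidueField.ObservableToSLER` (stmt-CriticalPhenomena-14005) SPLIT INTO ITS THREE RESEARCH RESIDUES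
# (crux-strategist s5 of route-CriticalPhenomena-SAWResidueField, 2026-08-17)

Landing target:
`Summits/CriticalPhenomena/SAWScalingLimit/Theorems/SAWResidueFieldObservableToSLERSplit.lean`
(`--workitem stmt-CriticalPhenomena-18179`: this file CLOSES the glue item `SAWResidueField.ObservableToSLERGlue` of the split of
2026-08-17 (route rev 17) — audit `proof-of-item observableToSLERGlue closed=True`; written and checked by the strategist seat s5, to be
landed by a prover since Theorems/ is prover-only).

`observableToSLERGlue` (= the glue item stmt-CriticalPhenomena-18179 `SAWResidueField.ObservableToSLERGlue`) — the glue of the typed 3-way decomposition of the crux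
`Summit.CriticalPhenomena.SAWScalingLimit.Theses.SAWResidueField.ObservableToSLER` (the route-SAWResidueField copy;
`Iff.rfl`-identical to the SAWDefectDecoherence / SAWDevelopingMap copies) into EXACTLY the three existing ledger items
that the live line `bridge-gate-renewal` (skeleton r15 = twin `six-class-type-ladder` r13) leaves open:

* `h1` = stmt-CriticalPhenomena-17698 `NestedRenewalFatCoSolidR` (S1: nested renewal abundance with fat co-oriented solid
  tame families, locality scale bounded) — the item text verbatim (its `open … in` prefix realised by this file's `open`s);
* `h2` = stmt-CriticalPhenomena-17955 `MacroSourceLocality` (T1⁻: macroscopic source locality at a flat root) — verbatim;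
* `h3` = stmt-CriticalPhenomena-7148 `HexSimpleSubseqLimits` (T5ₐ: simplicity of subsequential limits) — verbatim.

Proof = the landed weakened-anchor residue assembly `Residue.observableToSLER_of_residueMacro` (p148257: crux from
{S1, T1⁻, 7148, solid squeeze 5a4″}) with its fourth hypothesis, the solid moving-carving squeeze
`TwoPieceAdmRestrictionLimit → MovingCarvingSqueezeP FatAnchoredClassZeroSolid`, now DISCHARGED
(`carvedReduction_squeezeSolid` below): it is the skeleton's r8 glue over the twin line's LANDED T-A
`TypeLadder.carvedReduction_squeezeGeometry` (2026-08-17, over STAGE 1a p137830, STAGE 1b p162460 + T-A′₁ p147799, STAGE 2′ p154374)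
and the LANDED T-B `TypeLadder.stub_carvedReduction_ratioSqueeze` (p131716).  Hence, kernel-checked:

    NestedRenewalFatCoSolidR → MacroSourceLocality → HexSimpleSubseqLimits → SAWResidueField.ObservableToSLER.

None of the three children is the crux reworded (S1 has no SLE / observable content; T1⁻ is a boundary two-point mass estimate at
ONE flat root; 7148 carries no conformal information), and the crux's own hypotheses `HexObservableLimitR`, `HexTight` are consumed
inside the assembly (ARL″ via `Macro.stub_macroRestrictionLimit`; MidTightN / modulus via `stub_hexUniformModulus_of_simpleLimits`).
-/

noncomputable section

open scoped BigOperators Topology NNReal ENNReal Classical BoundedContinuousFunction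
open Filter Set MeasureTheory Metric
open Literature.Probability.LatticeModels
open Literature.Probability.RandomPlanarGeometry
open Literature.Probability.RandomPlanarGeometry.SAW
open UpperHalfPlane

namespace Summit.CriticalPhenomena.SAWScalingLimit.Theorems.ObservableToSLER.ResidueFieldSplit

open Summit.CriticalPhenomena.SAWScalingLimit.Theorems.ObservableToSLER.BridgeGate
open Summit.CriticalPhenomena.SAWScalingLimit.Theorems.ObservableToSLER.NestedGate

/-- **The solid moving-carving squeeze (registered stub 5a4″ `stub_carvedReduction_squeezeSolid` of line bridge-gate-renewal,
statement verbatim), now a THEOREM**: glue over the landed T-A `TypeLadder.carvedReduction_squeezeGeometry` and the landed T-B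
`TypeLadder.stub_carvedReduction_ratioSqueeze` (the skeleton's r8 glue, with the T-A leaf replaced by its landed namesake). -/
theorem carvedReduction_squeezeSolid :
    (∀ (D D' : DobrushinDomain) (ρ : ℝ) (φ : ConformalEquiv upperHalfPlaneSet D.carrier)
      (Φ : ConformalEquiv (upperHalfPlaneSet \ φ.pullbackHull D') upperHalfPlaneSet) (d : ℝ)
      (Λ Λ' : ℝ → Finset HexVertex) (m₀ m₁ m₁' : ℝ → ℤ) (a b : ℝ → Sym2 HexVertex),
      (0 < ρ ∧ ∀ i : Fin 2, D.carrier ∩ ball (D.pt i) ρ = {z : ℂ | (D.pt i).im < z.im} ∩ ball (D.pt i) ρ) →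
      D.IsHullSubdomain D' → D.IsChordalUniformizing φ →
      IsRestrictionMap (φ.pullbackHull D') Φ → HasRestrictionDeriv (φ.pullbackHull D') Φ d →
      (∀ᶠ δ : ℝ in 𝓝[>] 0,
        Λ' δ ⊆ Λ δ ∧ hexDomainSimplyConnected (Λ δ) ∧ hexDomainSimplyConnected (Λ' δ) ∧
        (hexGraph.induce (↑(Λ δ) : Set HexVertex)).Preconnected ∧
        (hexGraph.induce (↑(Λ' δ) : Set HexVertex)).Preconnected ∧
        a δ ∈ hexDomainBoundary (Λ δ) ∧ b δ ∈ hexDomainBoundary (Λ δ) ∧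
        a δ ∈ hexDomainBoundary (Λ' δ) ∧ b δ ∈ hexDomainBoundary (Λ' δ) ∧
        Nonempty (HexMidEdgeSAW (Λ' δ) (a δ) (b δ)) ∧
        (∀ v ∈ Λ δ, (δ : ℂ) * hexCenter v ∈ D.carrier) ∧
        (∀ v ∈ Λ' δ, (δ : ℂ) * hexCenter v ∈ D'.carrier) ∧
        (∀ v : HexVertex, (δ : ℂ) * hexCenter v ∈ ball (D.pt 0) ρ →
          ((v ∈ Λ δ ↔ m₀ δ ≤ v.1 1) ∧ (v ∈ Λ' δ ↔ m₀ δ ≤ v.1 1))) ∧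
        (∀ v : HexVertex, (δ : ℂ) * hexCenter v ∈ ball (D.pt 1) ρ →
          ((v ∈ Λ δ ↔ m₁ δ ≤ v.1 1) ∧ (v ∈ Λ' δ ↔ m₁' δ ≤ v.1 1)))) →
      (∀ K : Set ℂ, IsCompact K → K ⊆ D.carrier →
        ∀ᶠ δ : ℝ in 𝓝[>] 0, ∀ v : HexVertex, (δ : ℂ) * hexCenter v ∈ K → v ∈ Λ δ) →
      (∀ K : Set ℂ, IsCompact K → K ⊆ D'.carrier →
        ∀ᶠ δ : ℝ in 𝓝[>] 0, ∀ v : HexVertex, (δ : ℂ) * hexCenter v ∈ K → v ∈ Λ' δ) →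
      Tendsto (fun δ : ℝ => (δ : ℂ) * hexMidpoint (a δ)) (𝓝[>] 0) (𝓝 (D.pt 0)) →
      Tendsto (fun δ : ℝ => (δ : ℂ) * hexMidpoint (b δ)) (𝓝[>] 0) (𝓝 (D.pt 1)) →
      Tendsto (fun δ : ℝ =>
          (∑ γ : HexMidEdgeSAW (Λ' δ) (a δ) (b δ), hexCriticalFugacity ^ γ.length) /
            (∑ γ : HexMidEdgeSAW (Λ δ) (a δ) (b δ), hexCriticalFugacity ^ γ.length)) (𝓝[>] 0)
        (𝓝 (d ^ ((5 : ℝ) / 8)))) →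
    (∀ (D : DobrushinDomain) (a b : ℝ → HexVertex), IsEmbEndpointApprox hexGraph hexCenter D a b →
      ∀ η > (0 : ℝ), ∃ R₀ > (0 : ℝ), ∀ R ∈ Set.Ioc (0 : ℝ) R₀, ∀ ρ > (0 : ℝ), ∀ N : ℕ,
          ∀ (δ : ℕ → ℝ) (S T : ℕ → ℕ → Set HexVertex) (n n' : ℕ → ℕ) (q q' : ℕ → HexVertex),
            Tendsto δ atTop (𝓝[>] 0) →
            (∀ k, TameNestedFamily (δ k) R N (a (δ k)) (S k) ∧
              TameNestedFamily (δ k) R N (b (δ k)) (T k) ∧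
              (((∀ i, ExteriorAnchored D.carrier (δ k) (S k i) (a (δ k))) ∧
          (∀ i, ExteriorAnchored D.carrier (δ k) (T k i) (b (δ k))) ∧
          (∀ (i : ℕ) (p q : HexVertex), HasCleanWindow D.carrier (δ k) ρ (S k i) p q →
            rowOf 0 q = rowOf 0 p + 1 ∧
              ∀ x : HexVertex, ((δ k : ℝ) : ℂ) * hexCenter x ∈ ball (((δ k : ℝ) : ℂ) * hexCenter q) ρ →
                (x ∈ S k i ↔ rowOf 0 x ≤ rowOf 0 p)) ∧
          (∀ (i : ℕ) (p q : HexVertex), HasCleanWindow D.carrier (δ k) ρ (T k i) p q →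
            rowOf 0 q = rowOf 0 p + 1 ∧
              ∀ x : HexVertex, ((δ k : ℝ) : ℂ) * hexCenter x ∈ ball (((δ k : ℝ) : ℂ) * hexCenter q) ρ →
                (x ∈ T k i ↔ rowOf 0 x ≤ rowOf 0 p))) ∧
          (∀ (i : ℕ) (p q : HexVertex), HasCleanWindow D.carrier (δ k) ρ (S k i) p q →
            ∃ K : Set ℂ, IsCompact K ∧ IsConnected K ∧
              ((δ k : ℝ) : ℂ) * hexCenter q - ((ρ / 2 : ℝ) : ℂ) * Complex.I ∈ K ∧ ((δ k : ℝ) : ℂ) * hexCenter (a (δ k)) ∈ K ∧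
              ∀ v : HexVertex, Metric.infDist (((δ k : ℝ) : ℂ) * hexCenter v) K ≤ ρ / 4 → v ∈ S k i) ∧
          (∀ (i : ℕ) (p q : HexVertex), HasCleanWindow D.carrier (δ k) ρ (T k i) p q →
            ∃ K : Set ℂ, IsCompact K ∧ IsConnected K ∧
              ((δ k : ℝ) : ℂ) * hexCenter q - ((ρ / 2 : ℝ) : ℂ) * Complex.I ∈ K ∧ ((δ k : ℝ) : ℂ) * hexCenter (b (δ k)) ∈ K ∧
              ∀ v : HexVertex, Metric.infDist (((δ k : ℝ) : ℂ) * hexCenter v) K ≤ ρ / 4 → v ∈ T k i) ∧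
          (∀ i : ℕ, ∃ K : Set ℂ, IsCompact K ∧ IsConnected K ∧ ((δ k : ℝ) : ℂ) * hexCenter (a (δ k)) ∈ K ∧
            (∀ v : HexVertex, Metric.infDist (((δ k : ℝ) : ℂ) * hexCenter v) K ≤ ρ / 8 → v ∈ S k i) ∧
            (∀ v ∈ S k i, ∃ (t w : HexVertex) (r : ℕ), v ∈ hexBall t r ∧ w ∈ hexBall t r ∧
              hexBall t r ⊆ S k i ∧ Metric.infDist (((δ k : ℝ) : ℂ) * hexCenter w) K ≤ ρ / 16)) ∧
          (∀ i : ℕ, ∃ K : Set ℂ, IsCompact K ∧ IsConnected K ∧ ((δ k : ℝ) : ℂ) * hexCenter (b (δ k)) ∈ K ∧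
            (∀ v : HexVertex, Metric.infDist (((δ k : ℝ) : ℂ) * hexCenter v) K ≤ ρ / 8 → v ∈ T k i) ∧
            (∀ v ∈ T k i, ∃ (t w : HexVertex) (r : ℕ), v ∈ hexBall t r ∧ w ∈ hexBall t r ∧
              hexBall t r ⊆ T k i ∧ Metric.infDist (((δ k : ℝ) : ℂ) * hexCenter w) K ≤ ρ / 16)))) →
            (∀ k, ∃ (γ : HexDomainSAW D.carrier (δ k) (a (δ k)) (b (δ k))) (m : ℕ) (p : HexVertex)
                (m' : ℕ) (p' : HexVertex),
              IsFirstGoodGateN D.carrier (δ k) ρ R (S k) (a (δ k)) γ.walk.support (n k) m p (q k) ∧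
              IsFirstGoodGateN D.carrier (δ k) ρ R (T k) (b (δ k)) γ.walk.support.reverse
                (n' k) m' p' (q' k) ∧
              WideLink D.carrier (δ k) ρ (S k (n k) ∪ T k (n' k)) (q k) (q' k)) →
            ∀ ε' > (0 : ℝ), ∀ φ : ℕ → ℕ, StrictMono φ →
              ∃ (ψ : ℕ → ℕ) (M : DobrushinDomain) (τ : ℂ) (ρ' : ℝ) (Λ' : ℝ → Finset HexVertex)
                (m : Fin 2 → ℝ → ℤ) (a' b' : ℝ → Sym2 HexVertex) (x : ℕ → Site 2)
                (Λ'' : ℕ → Finset HexVertex) (pu pv : ℕ → HexVertex),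
                StrictMono ψ ∧
                (∀ t : ℝ, dist (M.boundary t + τ) (D.boundary t) ≤ η) ∧
                dist (M.pt 0 + τ) (D.pt 0) ≤ η ∧ dist (M.pt 1 + τ) (D.pt 1) ≤ η ∧
                (0 < ρ' ∧ ∀ i : Fin 2,
                  M.carrier ∩ ball (M.pt i) ρ' = {z : ℂ | (M.pt i).im < z.im} ∩ ball (M.pt i) ρ') ∧
                (∀ᶠ δ' : ℝ in 𝓝[>] 0, hexDomainSimplyConnected (Λ' δ') ∧
                  a' δ' ∈ hexDomainBoundary (Λ' δ') ∧ b' δ' ∈ hexDomainBoundary (Λ' δ') ∧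
                  Nonempty (HexMidEdgeSAW (Λ' δ') (a' δ') (b' δ')) ∧
                  (hexGraph.induce (↑(Λ' δ') : Set HexVertex)).Preconnected ∧
                  (∀ v ∈ Λ' δ', (δ' : ℂ) * hexCenter v ∈ M.carrier) ∧
                  (∀ i : Fin 2, ∀ v : HexVertex, (δ' : ℂ) * hexCenter v ∈ ball (M.pt i) ρ' →
                    (v ∈ Λ' δ' ↔ m i δ' ≤ v.1 1))) ∧
                (∀ K : Set ℂ, IsCompact K → K ⊆ M.carrier →
                  ∀ᶠ δ' : ℝ in 𝓝[>] 0, ∀ v : HexVertex, (δ' : ℂ) * hexCenter v ∈ K → v ∈ Λ' δ') ∧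
                Tendsto (fun δ' : ℝ => (δ' : ℂ) * hexMidpoint (a' δ')) (𝓝[>] 0) (𝓝 (M.pt 0)) ∧
                Tendsto (fun δ' : ℝ => (δ' : ℂ) * hexMidpoint (b' δ')) (𝓝[>] 0) (𝓝 (M.pt 1)) ∧
                Tendsto (fun j : ℕ => ((δ (φ (ψ j)) : ℝ) : ℂ) *
                  Literature.Probability.LatticeModels.triEmbed (x j)) atTop (𝓝 τ) ∧
                (∀ j : ℕ,
                  (∀ w : HexVertex, w ∈ Λ'' j ↔ ((-(x j) + w.1, w.2) : HexVertex) ∈ Λ' (δ (φ (ψ j)))) ∧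
                  (∀ w ∈ Λ'' j, w ∉ S (φ (ψ j)) (n (φ (ψ j))) ∪ T (φ (ψ j)) (n' (φ (ψ j)))) ∧
                  (∀ w ∈ Λ'' j, ∀ y ∈ Λ'' j, hexGraph.Adj w y →
                    (hexDomainGraph D.carrier (δ (φ (ψ j)))).Adj w y) ∧
                  q (φ (ψ j)) ∈ Λ'' j ∧
                  pu j ∈ S (φ (ψ j)) (n (φ (ψ j))) ∪ T (φ (ψ j)) (n' (φ (ψ j))) ∧
                  pv j ∈ S (φ (ψ j)) (n (φ (ψ j))) ∪ T (φ (ψ j)) (n' (φ (ψ j))) ∧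
                  hexGraph.Adj (q (φ (ψ j))) (pu j) ∧
                  s(q (φ (ψ j)), pu j) ≠ s(q' (φ (ψ j)), pv j) ∧
                  (a' (δ (φ (ψ j)))).map (fun w : HexVertex => ((x j + w.1, w.2) : HexVertex)) =
                    s(q (φ (ψ j)), pu j) ∧
                  (b' (δ (φ (ψ j)))).map (fun w : HexVertex => ((x j + w.1, w.2) : HexVertex)) =
                    s(q' (φ (ψ j)), pv j)) ∧
                (∀ᶠ j : ℕ in atTop, 1 - ε' ≤
                  (carvedLaw D.carrier (δ (φ (ψ j))) (S (φ (ψ j)) (n (φ (ψ j))) ∪ T (φ (ψ j)) (n' (φ (ψ j))))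
                    (q (φ (ψ j))) (q' (φ (ψ j))) {ξ | ∀ w ∈ ξ.walk.support, w ∈ Λ'' j}).toReal)) := by
  intro hARL D a b hab η hη
  obtain ⟨R₀, hR₀, hmain⟩ := Summit.CriticalPhenomena.SAWScalingLimit.Theorems.ObservableToSLE.TypeLadder.carvedReduction_squeezeGeometry D a b hab η hη
  refine ⟨R₀, hR₀, fun R hR ρ hρ N δ S T n n' q q' hδ hfam hgates ε' hε' φ hφ => ?_⟩
  obtain ⟨ψ, M, τ, ρ', Λ', m, a', b', x, Λ'', pu, pv, h1, h2, h3, h4, h5, h6, h7, h8, h9, h10, h11,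
    E, ρE, φE, Φ, d, Nf, m₀, m₁, m₁', hflat, hHull, hφE, hΦ, hd, hlev, hadm, hexhE, hexhM, haE, hbE, hcell⟩ :=
    hmain R hR ρ hρ N δ S T n n' q q' hδ hfam hgates ε' hε' φ hφ
  refine ⟨ψ, M, τ, ρ', Λ', m, a', b', x, Λ'', pu, pv, h1, h2, h3, h4, h5, h6, h7, h8, h9, h10, h11, ?_⟩
  exact Summit.CriticalPhenomena.SAWScalingLimit.Theorems.ObservableToSLE.TypeLadder.stub_carvedReduction_ratioSqueeze hARL D.carrier (fun j => δ (φ (ψ j)))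
    (fun j => S (φ (ψ j)) (n (φ (ψ j))) ∪ T (φ (ψ j)) (n' (φ (ψ j)))) (fun j => q (φ (ψ j)))
    (fun j => q' (φ (ψ j))) pu pv x Λ'' E M ρE φE Φ d Nf Λ' m₀ m₁ m₁' a' b' ε' D.isBounded
    (hδ.comp (hφ.comp h1).tendsto_atTop) hflat hHull hφE hΦ hd hlev hadm hexhE hexhM haE hbE hcell

/-- **THE GLUE ITEM stmt-CriticalPhenomena-18179 `SAWResidueField.ObservableToSLERGlue`** (split of 2026-08-17, route rev 17):
`NestedRenewalFatCoSolidR → MacroSourceLocality → HexSimpleSubseqLimits → ObservableToSLER` in the route's own decls, i.e.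
(item stmt-17698, verbatim) → (item stmt-17955, verbatim) → (item stmt-7148, verbatim) → the crux.  Proof: the landed weakened-anchor
residue assembly `Residue.observableToSLER_of_residueMacro` (p148257) with its squeeze hypothesis discharged by
`carvedReduction_squeezeSolid`; the route defs unfold to the item texts and the SAWResidueField / SAWDefectDecoherence copies of
`HexObservableLimitR`, `HexTight`, `ObservableToSLER` are syntactically identical (`Iff.rfl`). -/
theorem observableToSLERGlue :
    Summit.CriticalPhenomena.SAWScalingLimit.Theses.SAWResidueField.ObservableToSLERGlue :=
  fun h1 h2 h3 hR hT =>
    Summit.CriticalPhenomena.SAWScalingLimit.Theorems.ObservableToSLER.Residue.observableToSLER_of_residueMacro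
      h1 h2 h3 carvedReduction_squeezeSolid hR hT

end Summit.CriticalPhenomena.SAWScalingLimit.Theorems.ObservableToSLER.ResidueFieldSplit

end
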